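import Summits.Ventures.PercRepro.C041ZoneZFSteps
import Summits.Ventures.PercRepro.C041ZoneZ

/-!
# THEOREM Z′ — the ZONE LEMMA WITH FORCED EDGES of C-041.md §13 is a theorem: `|𝓛_Z| ≤ |𝓡_Z|` (p6, gen 27)

Setting of `C041ZoneZFSteps` (a zone with forced edges `F : FZone`; `A` the anchors, `Q` the protected anchors).
The FORCING FORM `Κ = 𝓛_Z ⊔ W`, `Ρ′ = 𝓡_Z ⊔ W` (`KsetFF_eq_union`, `PsetFF_eq_union`) and the CHAIN
`#Κ ≤ #K2 ≤ #P2 ≤ #Ρ′` by the three injections `psiF`, `chiF`, `phiF` — exactly as in `C041ZoneZ`, with `Forced`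
carried along.

* **`card_LsetFF_le_card_RsetFF`** — THEOREM Z′ (C-041.md §13): `#(LsetFF Q A) ≤ #(RsetFF Q A)` for every finite zone with
  forced-red edges anywhere and forced-blue edges inside an unmarked blue-isolated region, every anchor set and every
  protected anchor set (the plain lemma at `Q = ∅`, the `c`-variant at `Q = {c}`).

This is the form that applies to the WHOLE skeleton with anchor set `K₀` (C-041.md §13, THEOREM (INV)); that
application — the dictionary from the cube states of `C041RcPortINV` — is the next module.
-/

namespace PercRepro

namespace ZoneZ

namespace FZone

open Finset ZoneData

variable {V E T₁ T₂ : Type*} (F : FZone V E T₁ T₂) (Q A : Set V)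

variable [Fintype E] [DecidableEq E] [Fintype T₁] [DecidableEq T₁] [Fintype T₂] [DecidableEq T₂]

/-! ## Membership -/

/-- Membership in `𝓛_Z`. -/
theorem mem_LsetF {σ : State E T₁ T₂} :
    σ ∈ F.LsetF Q A ↔ F.Forced σ ∧ F.adm σ ∧ F.blueK A σ ∧ F.anchorDel A σ ∧ F.Gam Q σ := by
  classical
  unfold LsetF
  rw [Finset.mem_filter]
  exact and_iff_right (Finset.mem_univ _)

/-- Membership in `𝓡_Z`. -/
theorem mem_RsetF {σ : State E T₁ T₂} :
    σ ∈ F.RsetF Q A ↔ F.Forced σ ∧ F.adm σ ∧ ¬ F.anchorDel A σ ∧ F.reach2 A σ ∧ ¬ F.blueK A σ ∧ F.Gam Q σ := by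
  classical
  unfold RsetF
  rw [Finset.mem_filter]
  exact and_iff_right (Finset.mem_univ _)

/-- Membership in `Κ`. -/
theorem mem_KsetF {σ : State E T₁ T₂} : σ ∈ F.KsetF Q A ↔ F.Forced σ ∧ F.adm σ ∧ F.blueK A σ ∧ F.Gam Q σ := by
  classical
  unfold KsetF
  rw [Finset.mem_filter]
  exact and_iff_right (Finset.mem_univ _)

/-- Membership in `Ρ′`. -/
theorem mem_PsetF {σ : State E T₁ T₂} :
    σ ∈ F.PsetF Q A ↔ F.Forced σ ∧ F.adm σ ∧ ¬ F.anchorDel A σ ∧ F.reach2 A σ ∧ F.Gam Q σ := by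
  classical
  unfold PsetF
  rw [Finset.mem_filter]
  exact and_iff_right (Finset.mem_univ _)

/-- Membership in `W`. -/
theorem mem_WsetF {σ : State E T₁ T₂} :
    σ ∈ F.WsetF Q A ↔ F.Forced σ ∧ F.adm σ ∧ ¬ F.anchorDel A σ ∧ F.blueK A σ ∧ F.Gam Q σ := by
  classical
  unfold WsetF
  rw [Finset.mem_filter]
  exact and_iff_right (Finset.mem_univ _)

/-- Membership in `K2`. -/
theorem mem_K2setF {σ : State E T₁ T₂} :
    σ ∈ F.K2setF Q A ↔ F.Forced σ ∧ Disjoint (F.M σ) (reachIn (F.FreeRedAdj σ) (F.P Q σ)ᶜ (F.Blt σ)) ∧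
      Disjoint (F.CmixF Q A σ) (F.Bl σ ∪ F.Mt σ ∪ (F.Blt σ ∩ F.P Q σ)) ∧ F.Gam Q σ := by
  classical
  unfold K2setF
  rw [Finset.mem_filter]
  exact and_iff_right (Finset.mem_univ _)

/-- Membership in `P2`. -/
theorem mem_P2setF {σ : State E T₁ T₂} :
    σ ∈ F.P2setF Q A ↔ F.Forced σ ∧ F.adm σ ∧ Disjoint (F.CmixF Q A σ) (F.Bl σ ∪ F.Mt σ) ∧ F.Gam Q σ := by
  classical
  unfold P2setF
  rw [Finset.mem_filter]
  exact and_iff_right (Finset.mem_univ _)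

/-! ## The forcing form (L0) -/

/-- `Κ = 𝓛_Z ∪ W`. -/
theorem KsetF_eq_union : F.KsetF Q A = F.LsetF Q A ∪ F.WsetF Q A := by
  ext σ
  rw [Finset.mem_union, F.mem_KsetF, F.mem_LsetF, F.mem_WsetF]
  constructor
  · rintro ⟨h0, h1, h2, h3⟩
    by_cases h : F.anchorDel A σ
    · exact Or.inl ⟨h0, h1, h2, h, h3⟩
    · exact Or.inr ⟨h0, h1, h, h2, h3⟩
  · rintro (⟨h0, h1, h2, _, h3⟩ | ⟨h0, h1, _, h2, h3⟩) <;> exact ⟨h0, h1, h2, h3⟩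

/-- `Ρ′ = 𝓡_Z ∪ W`. -/
theorem PsetF_eq_union : F.PsetF Q A = F.RsetF Q A ∪ F.WsetF Q A := by
  ext σ
  rw [Finset.mem_union, F.mem_PsetF, F.mem_RsetF, F.mem_WsetF]
  constructor
  · rintro ⟨h0, h1, h2, h3, h4⟩
    by_cases h : F.blueK A σ
    · exact Or.inr ⟨h0, h1, h2, h, h4⟩
    · exact Or.inl ⟨h0, h1, h2, h3, h, h4⟩
  · rintro (⟨h0, h1, h2, h3, _, h4⟩ | ⟨h0, h1, h2, h3, h4⟩)
    · exact ⟨h0, h1, h2, h3, h4⟩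
    · exact ⟨h0, h1, h2, F.reach2_of_blueK A h3, h4⟩

/-- `𝓛_Z ∩ W = ∅`. -/
theorem disjoint_LsetF_WsetF : Disjoint (F.LsetF Q A) (F.WsetF Q A) := by
  rw [Finset.disjoint_left]
  intro σ h h'
  rw [F.mem_LsetF] at h
  rw [F.mem_WsetF] at h'
  exact h'.2.2.1 h.2.2.2.1

/-- `𝓡_Z ∩ W = ∅`. -/
theorem disjoint_RsetF_WsetF : Disjoint (F.RsetF Q A) (F.WsetF Q A) := by
  rw [Finset.disjoint_left]
  intro σ h h'
  rw [F.mem_RsetF] at h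
  rw [F.mem_WsetF] at h'
  exact h.2.2.2.2.1 h'.2.2.2.1

/-- `#Κ = #𝓛_Z + #W`. -/
theorem card_KsetF_eq : #(F.KsetF Q A) = #(F.LsetF Q A) + #(F.WsetF Q A) := by
  rw [F.KsetF_eq_union Q A, Finset.card_union_of_disjoint (F.disjoint_LsetF_WsetF Q A)]

/-- `#Ρ′ = #𝓡_Z + #W`. -/
theorem card_PsetF_eq : #(F.PsetF Q A) = #(F.RsetF Q A) + #(F.WsetF Q A) := by
  rw [F.PsetF_eq_union Q A, Finset.card_union_of_disjoint (F.disjoint_RsetF_WsetF Q A)]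

/-! ## The chain `#Κ ≤ #K2 ≤ #P2 ≤ #Ρ′` -/

/-- STEP 2 counted: `#Κ ≤ #K2` through the injection `psi`. -/
theorem card_KsetF_le_card_K2setF : #(F.KsetF Q A) ≤ #(F.K2setF Q A) := by
  refine Finset.card_le_card_of_injOn (F.psiF Q) ?_ fun σ _ σ' _ h => F.psiF_injective Q h
  intro σ hσ
  rw [Finset.mem_coe, F.mem_KsetF] at hσ
  rw [Finset.mem_coe, F.mem_K2setF]
  exact F.psiF_mem Q A σ hσ.1 hσ.2.1 hσ.2.2.1 hσ.2.2.2

/-- STEP 3 counted: `#K2 ≤ #P2` through the injection `chi`. -/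
theorem card_K2setF_le_card_P2setF : #(F.K2setF Q A) ≤ #(F.P2setF Q A) := by
  refine Finset.card_le_card_of_injOn (F.chiF Q A) ?_ fun σ _ σ' _ h => F.chiF_injective Q A h
  intro σ hσ
  rw [Finset.mem_coe, F.mem_K2setF] at hσ
  rw [Finset.mem_coe, F.mem_P2setF]
  exact F.chiF_mem Q A σ hσ.1 hσ.2.1 hσ.2.2.1 hσ.2.2.2

/-- STEP 1 counted: `#P2 ≤ #Ρ′` through the injection `phi`. -/
theorem card_P2setF_le_card_PsetF : #(F.P2setF Q A) ≤ #(F.PsetF Q A) := by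
  refine Finset.card_le_card_of_injOn (F.phiF Q) ?_ fun σ _ σ' _ h => F.phiF_injective Q h
  intro σ hσ
  rw [Finset.mem_coe, F.mem_P2setF] at hσ
  rw [Finset.mem_coe, F.mem_PsetF]
  exact F.phiF_mem Q A σ hσ.1 hσ.2.1 hσ.2.2.1 hσ.2.2.2

/-- The forcing form: `#Κ ≤ #Ρ′`. -/
theorem card_KsetF_le_card_PsetF : #(F.KsetF Q A) ≤ #(F.PsetF Q A) :=
  (F.card_KsetF_le_card_K2setF Q A).trans ((F.card_K2setF_le_card_P2setF Q A).trans (F.card_P2setF_le_card_PsetF Q A))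

/-! ## THEOREM Z′ -/

/-- **THEOREM Z′** (C-041.md §13): `|𝓛_Z| ≤ |𝓡_Z|` for every finite zone with forced edges (forced-red anywhere,
forced-blue inside an unmarked blue-isolated region), every anchor set `A` and every protected anchor set `Q`. -/
theorem card_LsetF_le_card_RsetF : #(F.LsetF Q A) ≤ #(F.RsetF Q A) := by
  have h := F.card_KsetF_le_card_PsetF Q A
  rw [F.card_KsetF_eq Q A, F.card_PsetF_eq Q A] at h
  exact Nat.le_of_add_le_add_right h

end FZone

end ZoneZ

end PercRepro
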